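/-
Copyright: statement-level skeleton of a published paper (lit-balaban cell, Phase-2 proof seat p25, gen 17). No proof
claims beyond what the kernel checks below.
-/
import Literature.MathematicalPhysics.QuantumFieldTheory.BalabanImbrieJaffe1984to88.BIJ88LabelledTermCount312
import Literature.MathematicalPhysics.QuantumFieldTheory.BalabanImbrieJaffe1984to88.BIJ88ComponentCubes311

/-!
# `BalabanImbrieJaffe1984to88.BIJ88LabelledDiamDecay312` — T. Bałaban, J. Imbrie, A. Jaffe, *Effective action and cluster
properties of the abelian Higgs model*, Commun. Math. Phys. **114** (1988) 257–315 [BalabanImbrieJaffe1988], §5.14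
p. 311 [PDF 55]: *"Each F^{m̄}_{k,loc}(X_{σ_i}) is a polynomial in A^{(k)}, φ^{(k)}; those fields can be contracted via
covariances C^{(k)}_{Λ(k)} or C^{(k)}_{Λ(k)}(u_{k+1}) to other observables, to χ′_{Λ(k)}, or to the interaction. … For each
term, let X be the union of the cubes covering the X_{σ_i} and the regions from the random walk expansion. … We break
up the observable according to the connected components of X."* — **GEOMETRY, FIRST STEP: THE CUBES OF A COMPONENT AND
THE DECAY OF ITS WEIGHT IN THEIR DIAMETER.**  In the labelled expansion of p25 gen 16 (`BIJ88LabelledRun311`,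
`BIJ88LabelledExpansion311`) a component records its pending legs and the observables it contains; given a LOCATION
`loc w` of every leg `w` in a (pseudo)metric space of cubes, print's set `X` of a component becomes `cubes loc obs X` =
the locations of its pending legs and of all legs of its observables (sibling `BIJ88ComponentCubes311`).  If the
covariance brackets DECAY,
`|⟨A⁻¹u, v⟩| ≤ B·e^{−δ·dist(loc u, loc v)}` on `Dir`, and observables and vertices are LOCAL (all legs of one observable,
resp. of one vertex, within distance `r₀`), then every contraction that enlarges a component pays for the growth of
the diameter of its cubes (triangle inequality `diam(X ∪ Y) ≤ diam X + dist(x,y) + diam Y`), so that — on top of the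
uniform bookkeeping of `BIJ88LabelledCoefBound312` — every outcome of a run and every term of the expansion carries
`e^{−δ·diam}` of the cubes of each of its components: for `t ∈ expand 0 K`,
`|coef_t| · exp(δ·Σ_{X ∈ X_c's and X_r's of t} diam(cubes X)) ≤ (max B 1)^{Φ₀(K)} · e^{δr₀|K|} · (c_M e^{δr₀})^{nv_t}`
(`expand_decay_bound_init`).  This is the diameter half of print's locality (print's components are CONNECTED unions of
cubes because its `C_loc` has finite range and the rest goes into the random-walk trigger; with one covariance of
unrestricted range the honest statement is decay, and tree/volume decay is NOT claimed).

statement-level skeleton of published theorems with citation tags; proofs where landed; nothing here is a claim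
about the Yang–Mills mass gap

PDF held: `paper:balaban1988-cmp114-bij-abelian-higgs-effective-action` (journal page = PDF page + 256); p. 311 = PDF 55
(`p0055.txt` L25–35 re-read this session; the quoted sentences are verbatim there up to the OCR of sub/superscripts).

CITATION HEADER (lean-in-tree rule).  lit-balaban cell (HOME `run/shared/lean/pub/lit-balaban/`), Phase 2, seat p25
gen 17; row **C2.Claim@312** of `HOME/lit-balaban-r16/ROWS-C2-part2.md` (owner r16, referee ref-5; head
`BIJ88Sect5StatementsPart4.Ineq312` NOT touched — a MEMBER; first item of honest-scope (ii) GEOMETRY of the gen-16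
HANDOFF).  USED BY NAME, nothing restated: `BIJ88LabelledRun311` (`run`, `rpot`, `rpot_*`, `LGrp`, `pristine`,
`LGrp.absorb`, `Outcome`), `BIJ88LabelledRunEnv311` (`run_ind'`, `run_rest_subset`), `BIJ88LabelledExpansion311`
(`expand`, `RTerm`, `oact`, `tval`, `gintM`), `BIJ88LabelledCoefBound312.run_dir`, `BIJ88LabelledTermCount312.expand_pot_key`,
`BIJ88LabelledRemainderCount312.remainder_components_count`, `BIJ88ComponentCubes311` (`cubes`,
`diam_cubes_pair_le/_pristine_le/_absorb_le/_vertex_le`, `diam_cubes_pristine`), `BIJ88VertexComponents311.maxArity`.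

## What is proved (0 `sorry`, standard axioms, no definitions, no `Prop` facts)

* §2 **`run_decay_bound`** — for every outcome `o` of `run g rest done`:
  `|a_o|·m^{rpot o}·exp(δ(diam(cubes o.g) + Σ_{o.done}diam + r₀·#o.rest)) ≤ m^{rpot g}·exp(δ(diam(cubes g) + Σ_{done}diam
  + r₀·#rest))·(c_M e^{δr₀})^{dv_o}`, `m = max B 1`.
* §2b `run_rpot_dv_le`, §3a `expand_nv_le` (vertices are paid by the potential: `nv_t ≤ Φ`).
* §3 **`expand_decay_bound`**, **`expand_decay_bound_init`** (as displayed above), `tval_decay_bound_init` (the same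
  for the value `tval [] t` of a term of the resummed display), **`tval_decay_small`** (large factors × decay × small
  factors per term: `(max B 1)^{Φ₀}·e^{δr₀(|K|+Φ₀)} · Π_X e^{−δ diam X} · c_M^{M·#sat(t)} · |∫…|`).
HONEST SCOPE: contraction-graph components with ONE covariance (decaying, not finite-range): DIAMETER decay of each
component's cubes, not connectedness, not tree- or volume-decay (so not yet the `e^{−κ d(X)}`/Kotecký–Preiss currency
of `hobs`/`Ineq312`); the source bracket `⟨A⁻¹u, ℱ⟩` is only bounded (`B`), the vertex locations enter only through
their legs; `r₀`, `B`, `δ` are free parameters (nothing of Balaban's propagator estimates is used here).  CURRENCY: feeds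
none of `BIJ88Sect5StatementsPart4.Ineq312` / `hobs` / `RemainderComponent` by name and instantiates NONE of `Ineq312`'s
binders (`Q`, `Gk`, `cF`, `obsProd`, `nfree`, `θ`, `β′`): it supplies the `e^{−δ·diam(X)}` shape per block / remainder
component in the labelled currency, one ingredient of the `e^{−m′(c) d}` shape of print's `|F_{k,rem}|`, not the bridge
(which needs the `C_loc` split and the random-walk trigger).  NOT summit progress; NOT continuum; NOT Clay.  Imports `BIJ88LabelledTermCount312`, `BIJ88ComponentCubes311`; modifies nothing.
-/

noncomputable section

namespace Literature.MathematicalPhysics.QuantumFieldTheory.BalabanImbrieJaffe1984to88.BIJ88LabelledDiamDecay312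

open Classical Matrix Finset
open scoped BigOperators
open BIJ88VertexComponents311 (Grp maxArity)
open BIJ88LabelledRun311 BIJ88LabelledRunEnv311 BIJ88LabelledExpansion311 BIJ88LabelledRemainderCount312
open BIJ88LabelledCoefBound312 BIJ88LabelledTermCount312 BIJ88ComponentCubes311

variable {S : Type} [Fintype S] [DecidableEq S] {ι : Type} [Fintype ι] {κ : Type}
variable {β : Type} [PseudoMetricSpace β]

/-! ## §2  The weight of a run decays in the diameter of the cubes of its components -/

section Run

variable [DecidableEq κ]
variable {A : Matrix S S ℝ} {f : S → ℝ} {c : ι → ℝ} {legs : ι → List (S → ℝ)} {obs : κ → List (S → ℝ)} {M : ℕ}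
  {Dir : Set (S → ℝ)} {loc : (S → ℝ) → β} {B cM δ r₀ : ℝ}

omit [Fintype S] [DecidableEq S] [Fintype ι] [PseudoMetricSpace β] [DecidableEq κ] in
/-- One event of the run against the decorated potential (real arithmetic): a weight `W ≤ B'`, the induction
hypothesis at the new state and a budget inequality `B'·e^{P'}·T' ≤ m·e^{P}·T` give the bound at the old state.
[folklore] -/
private theorem step_decay {W x m B' E' P P' T T' : ℝ} {r' N' N : ℕ} (hw : W ≤ B') (hB' : 0 ≤ B') (hm : 1 ≤ m)
    (hx0 : 0 ≤ x) (hE' : 0 ≤ E') (hT : 0 ≤ T) (hx : x * m ^ r' * E' ≤ m ^ N' * (Real.exp P' * T'))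
    (hbud : B' * (Real.exp P' * T') ≤ m * (Real.exp P * T)) (hN : N' < N) :
    W * x * m ^ r' * E' ≤ m ^ N * (Real.exp P * T) := by
  have hm0 : 0 ≤ m := zero_le_one.trans hm
  calc W * x * m ^ r' * E' = W * (x * m ^ r' * E') := by ring
    _ ≤ B' * (m ^ N' * (Real.exp P' * T')) :=
        mul_le_mul hw hx (mul_nonneg (mul_nonneg hx0 (pow_nonneg hm0 _)) hE') hB'
    _ = m ^ N' * (B' * (Real.exp P' * T')) := by ring
    _ ≤ m ^ N' * (m * (Real.exp P * T)) := mul_le_mul_of_nonneg_left hbud (pow_nonneg hm0 _)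
    _ = m ^ (N' + 1) * (Real.exp P * T) := by ring
    _ ≤ m ^ N * (Real.exp P * T) := mul_le_mul_of_nonneg_right (pow_le_pow_right₀ hm (Nat.succ_le_of_lt hN))
        (mul_nonneg (Real.exp_pos _).le hT)

omit [Fintype S] [DecidableEq S] [Fintype ι] [PseudoMetricSpace β] [DecidableEq κ] in
/-- A decaying bracket bound is a uniform one: `B·e^{−x} ≤ max B 1` for `x ≥ 0`. [folklore] -/
private theorem mul_exp_neg_le_max {B x : ℝ} (hx : 0 ≤ x) : B * Real.exp (-x) ≤ max B 1 := by
  have he : Real.exp (-x) ≤ 1 := Real.exp_le_one_iff.2 (neg_nonpos.2 hx)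
  rcases le_or_gt 0 B with hB | hB
  · exact (mul_le_of_le_one_right hB he).trans (le_max_left _ _)
  · exact (mul_nonpos_iff.2 (Or.inr ⟨hB.le, (Real.exp_pos _).le⟩)).trans (zero_le_one.trans (le_max_right _ _))

/-- **THE WEIGHT OF A RUN DECAYS IN THE DIAMETER OF THE CUBES** (p. 311, the six contractions located): suppose the
brackets decay, `|⟨A⁻¹u, v⟩| ≤ B·e^{−δ·dist(loc u, loc v)}` for `u, v ∈ Dir` (`δ ≥ 0`), `|⟨A⁻¹u, ℱ⟩| ≤ B`, couplings
`|c_m| ≤ c_M`, every observable's legs and every vertex's legs lie within distance `r₀` of each other, and `Dir` holds all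
legs in play.  Then for every outcome `o` of `run g rest done`, with `m = max B 1`, `D(X) = diam(cubes X)`:
`|a_o| · m^{rpot o} · exp(δ·(D(o.g) + Σ_{h∈o.done} D(h) + r₀·#o.rest)) ≤ m^{rpot g rest done} · exp(δ·(D(g) + Σ_{h∈done}
D(h) + r₀·#rest)) · (c_M·e^{δ r₀})^{dv_o}` — a contraction `u — v` costs `B e^{−δ dist}` and enlarges the diameter by at
most `dist` (+ `r₀` for a fresh observable, paid by `#rest`, or a vertex, paid with its coupling; + `D(h)` for an
absorbed component, already on the books). [cite: BalabanImbrieJaffe1988, §5.14 p.311–312] -/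
theorem run_decay_bound (hδ : 0 ≤ δ) (hr : 0 ≤ r₀)
    (hBd : ∀ u ∈ Dir, ∀ v ∈ Dir, |(A⁻¹ *ᵥ u) ⬝ᵥ v| ≤ B * Real.exp (-(δ * dist (loc u) (loc v))))
    (hBf : ∀ u ∈ Dir, |(A⁻¹ *ᵥ u) ⬝ᵥ f| ≤ B) (hcM : 0 ≤ cM) (hcm : ∀ m, |c m| ≤ cM)
    (hobs : ∀ j, ∀ w ∈ obs j, w ∈ Dir) (hlegs : ∀ m, ∀ w ∈ legs m, w ∈ Dir)
    (hro : ∀ j, ∀ w ∈ obs j, ∀ w' ∈ obs j, dist (loc w) (loc w') ≤ r₀)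
    (hrv : ∀ m, ∀ w ∈ legs m, ∀ w' ∈ legs m, dist (loc w) (loc w') ≤ r₀)
    (g : LGrp S κ) (rest : Finset κ) (done : Multiset (LGrp S κ)) :
    ∀ o ∈ run A f c legs obs M g rest done, (∀ w ∈ g.pend, w ∈ Dir) → (∀ h ∈ done, ∀ w ∈ h.pend, w ∈ Dir) →
      |o.a| * (max B 1) ^ rpot obs M (maxArity legs) o.g o.rest o.done
          * Real.exp (δ * (Metric.diam (cubes loc obs o.g) + (o.done.map fun h => Metric.diam (cubes loc obs h)).sum
            + r₀ * o.rest.card))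
        ≤ (max B 1) ^ rpot obs M (maxArity legs) g rest done
          * (Real.exp (δ * (Metric.diam (cubes loc obs g) + (done.map fun h => Metric.diam (cubes loc obs h)).sum
            + r₀ * rest.card)) * (cM * Real.exp (δ * r₀)) ^ o.dv) := by
  have hm : 1 ≤ max B 1 := le_max_right B 1
  have hm0 : 0 ≤ max B 1 := zero_le_one.trans hm
  have hθ : 0 ≤ cM * Real.exp (δ * r₀) := mul_nonneg hcM (Real.exp_pos _).le
  refine run_ind' (P := fun g rest done o => (∀ w ∈ g.pend, w ∈ Dir) → (∀ h ∈ done, ∀ w ∈ h.pend, w ∈ Dir) →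
      |o.a| * (max B 1) ^ rpot obs M (maxArity legs) o.g o.rest o.done
          * Real.exp (δ * (Metric.diam (cubes loc obs o.g) + (o.done.map fun h => Metric.diam (cubes loc obs h)).sum
            + r₀ * o.rest.card))
        ≤ (max B 1) ^ rpot obs M (maxArity legs) g rest done
          * (Real.exp (δ * (Metric.diam (cubes loc obs g) + (done.map fun h => Metric.diam (cubes loc obs h)).sum
            + r₀ * rest.card)) * (cM * Real.exp (δ * r₀)) ^ o.dv)) ?_ ?_ ?_ ?_ ?_ ?_ ?_ g rest done
  · intro g rest done _ _ _
    simp only [abs_one, one_mul, pow_zero, mul_one, le_refl]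
  · -- (1) inside the component: weight ≤ m, cubes do not grow
    intro g rest done u L _ hp i o _ h hg hd
    have hu : u ∈ Dir := hg u (by rw [hp]; exact List.mem_cons_self)
    have hL : ∀ w ∈ L, w ∈ Dir := fun w hw => hg w (by rw [hp]; exact List.mem_cons_of_mem u hw)
    have ih := h (fun w hw => hL w (List.mem_of_mem_eraseIdx hw)) hd
    have hw : |(A⁻¹ *ᵥ u) ⬝ᵥ L.getD i 0| ≤ max B 1 := by
      by_cases hi : i < L.length
      · have hv : L.getD i 0 ∈ Dir := by rw [List.getD_eq_getElem _ _ hi]; exact hL _ (List.getElem_mem hi)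
        exact (hBd u hu _ hv).trans (mul_exp_neg_le_max (mul_nonneg hδ dist_nonneg))
      · rw [List.getD_eq_default _ _ (not_lt.1 hi), dotProduct_zero, abs_zero]; exact hm0
    have hD := diam_cubes_pair_le loc obs hp (P := L.eraseIdx i) (fun w hw => List.mem_of_mem_eraseIdx hw) g.nchi g.nv
    simp only [Outcome.scale_a, Outcome.scale_g, Outcome.scale_rest, Outcome.scale_done, Outcome.scale_dv, abs_mul]
    refine step_decay hw hm0 hm (abs_nonneg _) (Real.exp_pos _).le (pow_nonneg hθ _) ih ?_
      (rpot_pair obs M _ rest done hp i)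
    refine mul_le_mul_of_nonneg_left (mul_le_mul_of_nonneg_right (Real.exp_le_exp.2 ?_) (pow_nonneg hθ _)) hm0
    nlinarith
  · -- (2) a pristine observable joins: weight ≤ B e^{−δ d}, diameter + d + r₀, one observable fewer in `rest`
    intro g rest done u L _ hp j hj i o ho h hg hd
    have hu : u ∈ Dir := hg u (by rw [hp]; exact List.mem_cons_self)
    have hL : ∀ w ∈ L, w ∈ Dir := fun w hw => hg w (by rw [hp]; exact List.mem_cons_of_mem u hw)
    have ih := h (fun w hw => by
      rcases List.mem_append.1 hw with hw | hw
      · exact hL w hw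
      · exact hobs j w (List.mem_of_mem_eraseIdx hw)) hd
    have hcard : ((rest.erase j).card : ℝ) + 1 = rest.card := by exact_mod_cast Finset.card_erase_add_one hj
    simp only [Outcome.scale_a, Outcome.scale_g, Outcome.scale_rest, Outcome.scale_done, Outcome.scale_dv, abs_mul]
    by_cases hi : i < (obs j).length
    · have hv : (obs j).getD i 0 ∈ Dir := by rw [List.getD_eq_getElem _ _ hi]; exact hobs j _ (List.getElem_mem hi)
      have hB0 : 0 ≤ B := (mul_nonneg_iff_of_pos_right (Real.exp_pos _)).1 ((abs_nonneg _).trans (hBd u hu u hu))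
      have hD := diam_cubes_pristine_le loc obs hr hro hp j hi g.nchi g.nv
      refine step_decay (hBd u hu _ hv) (mul_nonneg hB0 (Real.exp_pos _).le) hm (abs_nonneg _) (Real.exp_pos _).le
        (pow_nonneg hθ _) ih ?_ (rpot_pristine obs M _ rest done hp hj i _)
      rw [mul_assoc, ← mul_assoc (Real.exp _), ← Real.exp_add, ← mul_assoc, ← mul_assoc]
      refine mul_le_mul (mul_le_mul (le_max_left B 1) (Real.exp_le_exp.2 ?_) (Real.exp_pos _).le hm0) le_rfl
        (pow_nonneg hθ _) (mul_nonneg hm0 (Real.exp_pos _).le)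
      rw [← hcard] at *
      nlinarith [mul_nonneg hδ hr]
    · rw [List.getD_eq_default _ _ (not_lt.1 hi), dotProduct_zero, abs_zero, zero_mul, zero_mul, zero_mul]
      exact mul_nonneg (pow_nonneg hm0 _) (mul_nonneg (Real.exp_pos _).le (pow_nonneg hθ _))
  · -- (3) a set-aside component joins: weight ≤ B e^{−δ d}, diameter + d + diam h, h leaves `done`
    intro g rest done u L _ hp h hh i hi o _ h' hg hd
    have hu : u ∈ Dir := hg u (by rw [hp]; exact List.mem_cons_self)
    have hL : ∀ w ∈ L, w ∈ Dir := fun w hw => hg w (by rw [hp]; exact List.mem_cons_of_mem u hw)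
    have ih := h' (fun w hw => by
      simp only [LGrp.absorb] at hw
      rcases List.mem_append.1 hw with hw | hw
      · exact hL w hw
      · exact hd h hh w (List.mem_of_mem_eraseIdx hw)) (fun h' hh' => hd h' (Multiset.mem_of_mem_erase hh'))
    have hv : h.pend.getD i 0 ∈ Dir := by rw [List.getD_eq_getElem _ _ hi]; exact hd h hh _ (List.getElem_mem hi)
    have hB0 : 0 ≤ B := (mul_nonneg_iff_of_pos_right (Real.exp_pos _)).1 ((abs_nonneg _).trans (hBd u hu u hu))
    have hD := diam_cubes_absorb_le loc obs hp hi (h := h)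
    have hE : (done.map fun h => Metric.diam (cubes loc obs h)).sum
        = Metric.diam (cubes loc obs h) + ((done.erase h).map fun h => Metric.diam (cubes loc obs h)).sum := by
      conv_lhs => rw [← Multiset.cons_erase hh]
      rw [Multiset.map_cons, Multiset.sum_cons]
    simp only [Outcome.scale_a, Outcome.scale_g, Outcome.scale_rest, Outcome.scale_done, Outcome.scale_dv, abs_mul]
    refine step_decay (hBd u hu _ hv) (mul_nonneg hB0 (Real.exp_pos _).le) hm (abs_nonneg _) (Real.exp_pos _).le
      (pow_nonneg hθ _) ih ?_ (rpot_absorb obs M _ rest done hp hh i)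
    rw [mul_assoc, ← mul_assoc (Real.exp _), ← Real.exp_add, ← mul_assoc, ← mul_assoc]
    refine mul_le_mul (mul_le_mul (le_max_left B 1) (Real.exp_le_exp.2 ?_) (Real.exp_pos _).le hm0) le_rfl
      (pow_nonneg hθ _) (mul_nonneg hm0 (Real.exp_pos _).le)
    rw [hE]
    nlinarith
  · -- (4) the source: weight ≤ B ≤ m, cubes do not grow
    intro g rest done u L _ hp o _ h hg hd
    have hu : u ∈ Dir := hg u (by rw [hp]; exact List.mem_cons_self)
    have hL : ∀ w ∈ L, w ∈ Dir := fun w hw => hg w (by rw [hp]; exact List.mem_cons_of_mem u hw)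
    have ih := h hL hd
    have hD := diam_cubes_pair_le loc obs hp (fun w hw => hw) g.nchi g.nv
    simp only [Outcome.scale_a, Outcome.scale_g, Outcome.scale_rest, Outcome.scale_done, Outcome.scale_dv, abs_mul]
    refine step_decay ((hBf u hu).trans (le_max_left B 1)) hm0 hm (abs_nonneg _) (Real.exp_pos _).le (pow_nonneg hθ _)
      ih ?_ (rpot_drop obs M _ rest done hp _)
    refine mul_le_mul_of_nonneg_left (mul_le_mul_of_nonneg_right (Real.exp_le_exp.2 ?_) (pow_nonneg hθ _)) hm0
    nlinarith
  · -- (5) χ′: no weight, cubes do not grow, the potential drops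
    intro g rest done u L _ hp o _ h hg hd
    have hL : ∀ w ∈ L, w ∈ Dir := fun w hw => hg w (by rw [hp]; exact List.mem_cons_of_mem u hw)
    have ih := h hL hd
    have hD := diam_cubes_pair_le loc obs hp (fun w hw => hw) (g.nchi + 1) g.nv
    simp only [Outcome.push_a, Outcome.push_g, Outcome.push_rest, Outcome.push_done, Outcome.push_dv]
    refine ih.trans (mul_le_mul (pow_le_pow_right₀ hm (rpot_drop obs M _ rest done hp _).le)
      (mul_le_mul_of_nonneg_right (Real.exp_le_exp.2 ?_) (pow_nonneg hθ _))
      (mul_nonneg (Real.exp_pos _).le (pow_nonneg hθ _)) (pow_nonneg hm0 _))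
    nlinarith
  · -- (6) a vertex: weight ≤ |c_m| B e^{−δ d}, diameter + d + r₀, one more coupling
    intro g rest done u L hc hp m j o _ h hg hd
    have hnv : g.nv < M := Grp.nv_lt_of_not_complete hc
    have hu : u ∈ Dir := hg u (by rw [hp]; exact List.mem_cons_self)
    have hL : ∀ w ∈ L, w ∈ Dir := fun w hw => hg w (by rw [hp]; exact List.mem_cons_of_mem u hw)
    have ih := h (fun w hw => by
      rcases List.mem_append.1 hw with hw | hw
      · exact hL w hw
      · exact hlegs m w (List.mem_of_mem_eraseIdx hw)) hd
    simp only [Outcome.bump_a, Outcome.bump_g, Outcome.bump_rest, Outcome.bump_done, Outcome.bump_dv, Outcome.scale_a,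
      Outcome.scale_g, Outcome.scale_rest, Outcome.scale_done, Outcome.scale_dv, neg_mul, abs_neg, abs_mul]
    by_cases hj : j < (legs m).length
    · have hv : (legs m).getD j 0 ∈ Dir := by rw [List.getD_eq_getElem _ _ hj]; exact hlegs m _ (List.getElem_mem hj)
      have hB0 : 0 ≤ B := (mul_nonneg_iff_of_pos_right (Real.exp_pos _)).1 ((abs_nonneg _).trans (hBd u hu u hu))
      have hD := diam_cubes_vertex_le loc obs hr hrv hp m hj g.nchi (g.nv + 1)
      have hw : |c m| * |(A⁻¹ *ᵥ u) ⬝ᵥ (legs m).getD j 0|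
          ≤ cM * (B * Real.exp (-(δ * dist (loc u) (loc ((legs m).getD j 0))))) :=
        mul_le_mul (hcm m) (hBd u hu _ hv) (abs_nonneg _) hcM
      refine step_decay hw (mul_nonneg hcM (mul_nonneg hB0 (Real.exp_pos _).le)) hm (abs_nonneg _) (Real.exp_pos _).le
        (pow_nonneg hθ _) ih ?_ (rpot_vertex obs M rest done legs hp hnv m j)
      rw [pow_succ]
      have key : cM * (B * Real.exp (-(δ * dist (loc u) (loc ((legs m).getD j 0)))))
          * Real.exp (δ * (Metric.diam (cubes loc obs ⟨⟨L ++ (legs m).eraseIdx j, g.nchi, g.nv + 1⟩, g.lab⟩)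
            + (done.map fun h => Metric.diam (cubes loc obs h)).sum + r₀ * rest.card))
          ≤ max B 1 * Real.exp (δ * (Metric.diam (cubes loc obs g)
            + (done.map fun h => Metric.diam (cubes loc obs h)).sum + r₀ * rest.card)) * (cM * Real.exp (δ * r₀)) := by
        have hexp : B * (Real.exp (-(δ * dist (loc u) (loc ((legs m).getD j 0))))
            * Real.exp (δ * (Metric.diam (cubes loc obs ⟨⟨L ++ (legs m).eraseIdx j, g.nchi, g.nv + 1⟩, g.lab⟩)
              + (done.map fun h => Metric.diam (cubes loc obs h)).sum + r₀ * rest.card)))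
            ≤ max B 1 * (Real.exp (δ * (Metric.diam (cubes loc obs g)
              + (done.map fun h => Metric.diam (cubes loc obs h)).sum + r₀ * rest.card)) * Real.exp (δ * r₀)) := by
          rw [← Real.exp_add, ← Real.exp_add]
          refine mul_le_mul (le_max_left B 1) (Real.exp_le_exp.2 ?_) (Real.exp_pos _).le hm0
          nlinarith
        calc _ = cM * (B * (Real.exp (-(δ * dist (loc u) (loc ((legs m).getD j 0))))
              * Real.exp (δ * (Metric.diam (cubes loc obs ⟨⟨L ++ (legs m).eraseIdx j, g.nchi, g.nv + 1⟩, g.lab⟩)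
                + (done.map fun h => Metric.diam (cubes loc obs h)).sum + r₀ * rest.card)))) := by ring
          _ ≤ cM * (max B 1 * (Real.exp (δ * (Metric.diam (cubes loc obs g)
              + (done.map fun h => Metric.diam (cubes loc obs h)).sum + r₀ * rest.card)) * Real.exp (δ * r₀))) :=
              mul_le_mul_of_nonneg_left hexp hcM
          _ = _ := by ring
      calc cM * (B * Real.exp (-(δ * dist (loc u) (loc ((legs m).getD j 0)))))
            * (Real.exp (δ * (Metric.diam (cubes loc obs ⟨⟨L ++ (legs m).eraseIdx j, g.nchi, g.nv + 1⟩, g.lab⟩)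
              + (done.map fun h => Metric.diam (cubes loc obs h)).sum + r₀ * rest.card)) * (cM * Real.exp (δ * r₀)) ^ o.dv)
          = (cM * (B * Real.exp (-(δ * dist (loc u) (loc ((legs m).getD j 0)))))
            * Real.exp (δ * (Metric.diam (cubes loc obs ⟨⟨L ++ (legs m).eraseIdx j, g.nchi, g.nv + 1⟩, g.lab⟩)
              + (done.map fun h => Metric.diam (cubes loc obs h)).sum + r₀ * rest.card)))
            * (cM * Real.exp (δ * r₀)) ^ o.dv := by ring
        _ ≤ (max B 1 * Real.exp (δ * (Metric.diam (cubes loc obs g)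
            + (done.map fun h => Metric.diam (cubes loc obs h)).sum + r₀ * rest.card)) * (cM * Real.exp (δ * r₀)))
            * (cM * Real.exp (δ * r₀)) ^ o.dv := mul_le_mul_of_nonneg_right key (pow_nonneg hθ _)
        _ = _ := by ring
    · rw [List.getD_eq_default _ _ (not_lt.1 hj), dotProduct_zero, abs_zero, mul_zero, zero_mul, zero_mul, zero_mul]
      exact mul_nonneg (pow_nonneg hm0 _) (mul_nonneg (Real.exp_pos _).le (pow_nonneg hθ _))

omit [PseudoMetricSpace β] in
/-- **Every vertex differentiated down is paid by the potential**: `rpot o + dv_o ≤ rpot g rest done` for every outcome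
`o` of `run g rest done`. [cite: BalabanImbrieJaffe1988, §5.14 p.311] -/
theorem run_rpot_dv_le (g : LGrp S κ) (rest : Finset κ) (done : Multiset (LGrp S κ)) :
    ∀ o ∈ run A f c legs obs M g rest done,
      rpot obs M (maxArity legs) o.g o.rest o.done + o.dv ≤ rpot obs M (maxArity legs) g rest done := by
  refine run_ind' (P := fun g rest done o =>
      rpot obs M (maxArity legs) o.g o.rest o.done + o.dv ≤ rpot obs M (maxArity legs) g rest done)
    (fun _ _ _ _ => by simp) ?_ ?_ ?_ ?_ ?_ ?_ g rest done
  · intro g rest done u L _ hp i o _ h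
    rw [Outcome.scale_g, Outcome.scale_rest, Outcome.scale_done, Outcome.scale_dv]
    exact h.trans (rpot_pair obs M _ rest done hp i).le
  · intro g rest done u L _ hp j hj i o _ h
    rw [Outcome.scale_g, Outcome.scale_rest, Outcome.scale_done, Outcome.scale_dv]
    exact h.trans (rpot_pristine obs M _ rest done hp hj i _).le
  · intro g rest done u L _ hp h hh i _ o _ h'
    rw [Outcome.scale_g, Outcome.scale_rest, Outcome.scale_done, Outcome.scale_dv]
    exact h'.trans (rpot_absorb obs M _ rest done hp hh i).le
  · intro g rest done u L _ hp o _ h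
    rw [Outcome.scale_g, Outcome.scale_rest, Outcome.scale_done, Outcome.scale_dv]
    exact h.trans (rpot_drop obs M _ rest done hp _).le
  · intro g rest done u L _ hp o _ h
    rw [Outcome.push_g, Outcome.push_rest, Outcome.push_done, Outcome.push_dv]
    exact h.trans (rpot_drop obs M _ rest done hp _).le
  · intro g rest done u L hc hp m j o _ h
    rw [Outcome.bump_g, Outcome.bump_rest, Outcome.bump_done, Outcome.bump_dv, Outcome.scale_g, Outcome.scale_rest,
      Outcome.scale_done, Outcome.scale_dv, ← add_assoc]
    exact Nat.succ_le_of_lt (lt_of_le_of_lt h (rpot_vertex obs M rest done legs hp (Grp.nv_lt_of_not_complete hc) m j))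

end Run

/-! ## §3  Along the expansion: every block and every remainder component carries `e^{−δ diam}` -/

section Expand

variable [LinearOrder κ]
variable {A : Matrix S S ℝ} {f : S → ℝ} {c : ι → ℝ} {legs : ι → List (S → ℝ)} {obs : κ → List (S → ℝ)} {M : ℕ}
  {Dir : Set (S → ℝ)} {loc : (S → ℝ) → β} {B cM δ r₀ : ℝ}

omit [Fintype S] [DecidableEq S] [Fintype ι] [PseudoMetricSpace β] [LinearOrder κ] in
/-- Combining a run with the rest of the expansion, decorated by the exponential bookkeeping (real arithmetic).
[folklore] -/
private theorem combine_decay {a t m θ X X' Sm Sm' Y Yf : ℝ} {Re Rs Φ Φn dv nv : ℕ} (hm : 1 ≤ m) (hθ : 0 ≤ θ)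
    (hrun : |a| * m ^ Re * Real.exp X ≤ m ^ Rs * (Real.exp Y * θ ^ dv))
    (ih : |t| * Real.exp Sm' ≤ m ^ Φn * Real.exp X' * θ ^ nv) (hXS : X + Sm' = X' + Sm) (hY : Y ≤ Yf)
    (key : Rs + Φn ≤ Φ + Re) : |a * t| * Real.exp Sm ≤ m ^ Φ * Real.exp Yf * θ ^ (dv + nv) := by
  have hm0 : 0 < m := zero_lt_one.trans_le hm
  have h1 := mul_le_mul hrun ih (mul_nonneg (abs_nonneg _) (Real.exp_pos _).le)
    (mul_nonneg (pow_nonneg hm0.le _) (mul_nonneg (Real.exp_pos _).le (pow_nonneg hθ _)))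
  -- h1 : (|a| m^Re e^X)(|t| e^{Sm'}) ≤ (m^Rs e^Y θ^dv)(m^Φn e^{X'} θ^nv)
  have e1 : |a| * m ^ Re * Real.exp X * (|t| * Real.exp Sm')
      = (|a * t| * Real.exp Sm * m ^ Re) * Real.exp X' := by
    have hx : Real.exp X * Real.exp Sm' = Real.exp X' * Real.exp Sm := by rw [← Real.exp_add, ← Real.exp_add, hXS]
    rw [abs_mul]
    calc |a| * m ^ Re * Real.exp X * (|t| * Real.exp Sm') = |a| * |t| * m ^ Re * (Real.exp X * Real.exp Sm') := by ring
      _ = |a| * |t| * m ^ Re * (Real.exp X' * Real.exp Sm) := by rw [hx]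
      _ = _ := by ring
  have e2 : m ^ Rs * (Real.exp Y * θ ^ dv) * (m ^ Φn * Real.exp X' * θ ^ nv)
      = (m ^ (Rs + Φn) * Real.exp Y * θ ^ (dv + nv)) * Real.exp X' := by
    rw [pow_add, pow_add]; ring
  rw [e1, e2] at h1
  have h2 := le_of_mul_le_mul_right h1 (Real.exp_pos X')
  refine le_of_mul_le_mul_right (h2.trans ?_) (pow_pos hm0 Re)
  calc m ^ (Rs + Φn) * Real.exp Y * θ ^ (dv + nv) ≤ m ^ (Φ + Re) * Real.exp Yf * θ ^ (dv + nv) :=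
        mul_le_mul (mul_le_mul (pow_le_pow_right₀ hm key) (Real.exp_le_exp.2 hY) (Real.exp_pos _).le
          (pow_nonneg hm0.le _)) le_rfl (pow_nonneg hθ _) (mul_nonneg (pow_nonneg hm0.le _) (Real.exp_pos _).le)
    _ = m ^ Φ * Real.exp Yf * θ ^ (dv + nv) * m ^ Re := by rw [pow_add]; ring

omit [PseudoMetricSpace β] in
/-- **The vertices of a term are paid by the potential**: `nv_t ≤ Φ(done,rest)` for every term of `expand done rest`.
[cite: BalabanImbrieJaffe1988, §5.14 p.311] -/
theorem expand_nv_le : ∀ (n : ℕ) (done : Multiset (LGrp S κ)) (rest : Finset κ), rest.card < n →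
    ∀ t ∈ expand A f c legs obs M done rest,
      t.nv ≤ (done.map fun h => h.pend.length).sum + ∑ j ∈ rest, ((obs j).length + 1 + M * maxArity legs)
  | 0, _, _, hn => fun _ _ => absurd hn (Nat.not_lt_zero _)
  | n + 1, done, rest, hn => by
    intro t ht
    by_cases h : rest.Nonempty
    · rw [expand_of_nonempty A f c legs obs M h, mem_mbind] at ht
      obtain ⟨o, ho, ht⟩ := ht
      have hcard : o.rest.card < n := lt_of_lt_of_le (lt_of_le_of_lt (Finset.card_le_card (run_rest_subset _ _ _ o ho))
        (Finset.card_erase_lt_of_mem (rest.min'_mem h))) (Nat.lt_succ_iff.1 hn)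
      have hle := run_rpot_dv_le _ _ _ o ho
      split_ifs at ht with hg
      · rw [Multiset.mem_map] at ht
        obtain ⟨t', ht', rfl⟩ := ht
        have ih := expand_nv_le n o.done o.rest hcard t' ht'
        have key := expand_pot_key h done o ho 0 (Nat.zero_le _)
        rw [RTerm.addConst_nv, oact_nv]
        omega
      · rw [Multiset.mem_map] at ht
        obtain ⟨t', ht', rfl⟩ := ht
        have ih := expand_nv_le n (o.g ::ₘ o.done) o.rest hcard t' ht'
        have key := expand_pot_key h done o ho o.g.pend.length le_rfl
        rw [Multiset.map_cons, Multiset.sum_cons] at ih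
        rw [oact_nv]
        omega
    · rw [expand_of_not_nonempty A f c legs obs M h, Multiset.mem_singleton] at ht
      subst ht
      exact Nat.zero_le _

/-- **EVERY BLOCK AND EVERY REMAINDER COMPONENT CARRIES `e^{−δ·diam}`** (p. 311–312, located): under the hypotheses of
`run_decay_bound`, for complete components `done` set aside (pending legs in `Dir`) and untouched observables `rest`,
every term `t` of `expand done rest` satisfies
`|coef_t| · exp(δ · Σ_{X ∈ t.consts + t.groups} diam(cubes X)) ≤ (max B 1)^{Φ(done,rest)} · exp(δ · (Σ_{h∈done}
diam(cubes h) + r₀·#rest)) · (c_M e^{δr₀})^{nv_t}` — the run bounds telescope (`run_decay_bound`, `expand_pot_key`),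
the pristine component of a fresh observable having diameter `≤ r₀` (`diam_cubes_pristine`).
[cite: BalabanImbrieJaffe1988, §5.14 p.311–312] -/
theorem expand_decay_bound (hδ : 0 ≤ δ) (hr : 0 ≤ r₀)
    (hBd : ∀ u ∈ Dir, ∀ v ∈ Dir, |(A⁻¹ *ᵥ u) ⬝ᵥ v| ≤ B * Real.exp (-(δ * dist (loc u) (loc v))))
    (hBf : ∀ u ∈ Dir, |(A⁻¹ *ᵥ u) ⬝ᵥ f| ≤ B) (hcM : 0 ≤ cM) (hcm : ∀ m, |c m| ≤ cM)
    (hobs : ∀ j, ∀ w ∈ obs j, w ∈ Dir) (hlegs : ∀ m, ∀ w ∈ legs m, w ∈ Dir)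
    (hro : ∀ j, ∀ w ∈ obs j, ∀ w' ∈ obs j, dist (loc w) (loc w') ≤ r₀)
    (hrv : ∀ m, ∀ w ∈ legs m, ∀ w' ∈ legs m, dist (loc w) (loc w') ≤ r₀) :
    ∀ (n : ℕ) (done : Multiset (LGrp S κ)) (rest : Finset κ), rest.card < n →
      (∀ h ∈ done, ∀ w ∈ h.pend, w ∈ Dir) → ∀ t ∈ expand A f c legs obs M done rest,
        |t.coef| * Real.exp (δ * ((t.consts + t.groups).map fun h => Metric.diam (cubes loc obs h)).sum)
          ≤ (max B 1) ^ ((done.map fun h => h.pend.length).sum + ∑ j ∈ rest, ((obs j).length + 1 + M * maxArity legs))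
            * Real.exp (δ * ((done.map fun h => Metric.diam (cubes loc obs h)).sum + r₀ * rest.card))
            * (cM * Real.exp (δ * r₀)) ^ t.nv
  | 0, _, _, hn => fun _ _ _ => absurd hn (Nat.not_lt_zero _)
  | n + 1, done, rest, hn => by
    intro hd t ht
    have hm : 1 ≤ max B 1 := le_max_right B 1
    have hm0 : 0 ≤ max B 1 := zero_le_one.trans hm
    have hθ : 0 ≤ cM * Real.exp (δ * r₀) := mul_nonneg hcM (Real.exp_pos _).le
    by_cases h : rest.Nonempty
    · rw [expand_of_nonempty A f c legs obs M h, mem_mbind] at ht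
      obtain ⟨o, ho, ht⟩ := ht
      have hi := rest.min'_mem h
      have hcard : o.rest.card < n := lt_of_lt_of_le (lt_of_le_of_lt (Finset.card_le_card (run_rest_subset _ _ _ o ho))
        (Finset.card_erase_lt_of_mem hi)) (Nat.lt_succ_iff.1 hn)
      have hpr : ∀ w ∈ (pristine obs (rest.min' h)).pend, w ∈ Dir := hobs _
      obtain ⟨hog, hod⟩ := run_dir hobs hlegs _ _ _ o ho hpr hd
      have hrun := run_decay_bound hδ hr hBd hBf hcM hcm hobs hlegs hro hrv _ _ _ o ho hpr hd
      have hD0 := diam_cubes_pristine loc obs hr hro (rest.min' h)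
      have hce : ((rest.erase (rest.min' h)).card : ℝ) + 1 = rest.card := by exact_mod_cast Finset.card_erase_add_one hi
      have hY : δ * (Metric.diam (cubes loc obs (pristine obs (rest.min' h)))
            + (done.map fun h => Metric.diam (cubes loc obs h)).sum + r₀ * (rest.erase (rest.min' h)).card)
          ≤ δ * ((done.map fun h => Metric.diam (cubes loc obs h)).sum + r₀ * rest.card) := by
        rw [← hce]; nlinarith
      split_ifs at ht with hg
      · -- a constant component: booked as a block, its diameter joins the sum over the term's components
        rw [Multiset.mem_map] at ht
        obtain ⟨t', ht', rfl⟩ := ht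
        have ih := expand_decay_bound hδ hr hBd hBf hcM hcm hobs hlegs hro hrv n o.done o.rest hcard hod t' ht'
        have key := expand_pot_key h done o ho 0 (Nat.zero_le _)
        rw [zero_add] at key
        rw [RTerm.addConst_coef, oact_coef, RTerm.addConst_nv, oact_nv, RTerm.addConst_consts, oact_consts,
          RTerm.addConst_groups, oact_groups, Multiset.cons_add, Multiset.map_cons, Multiset.sum_cons]
        refine combine_decay hm hθ hrun ih ?_ hY key
        ring
      · -- a remainder component: set aside, its diameter goes on the books of `done`
        rw [Multiset.mem_map] at ht
        obtain ⟨t', ht', rfl⟩ := ht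
        have hod' : ∀ h ∈ o.g ::ₘ o.done, ∀ w ∈ h.pend, w ∈ Dir := fun h hh => by
          rcases Multiset.mem_cons.1 hh with rfl | hh
          · exact hog
          · exact hod h hh
        have ih := expand_decay_bound hδ hr hBd hBf hcM hcm hobs hlegs hro hrv n (o.g ::ₘ o.done) o.rest hcard hod' t' ht'
        have key := expand_pot_key h done o ho o.g.pend.length le_rfl
        rw [Multiset.map_cons, Multiset.sum_cons, Multiset.map_cons, Multiset.sum_cons] at ih
        rw [oact_coef, oact_nv, oact_consts, oact_groups]
        refine combine_decay hm hθ hrun ih ?_ hY key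
        ring
    · rw [expand_of_not_nonempty A f c legs obs M h, Multiset.mem_singleton] at ht
      subst ht
      obtain rfl := Finset.not_nonempty_iff_eq_empty.1 h
      simp only [abs_one, one_mul, zero_add, pow_zero, mul_one, Finset.card_empty, Nat.cast_zero, mul_zero, add_zero]
      exact le_mul_of_one_le_left (Real.exp_pos _).le (one_le_pow₀ hm)

/-- **EVERY BLOCK `X_c` AND EVERY REMAINDER COMPONENT `X_r` OF THE EXPANSION OF A PRODUCT OF OBSERVABLES `K` DECAYS IN
THE DIAMETER OF ITS CUBES**: for `t ∈ expand 0 K`,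
`|coef_t| · exp(δ·Σ_{X ∈ X_c's, X_r's of t} diam(cubes X)) ≤ (max B 1)^{Φ₀(K)} · e^{δ r₀ |K|} · (c_M e^{δ r₀})^{nv_t}`, i.e.
`|coef_t| ≤ (max B 1)^{Φ₀(K)} e^{δ r₀ (|K| + nv_t)} c_M^{nv_t} · Π_X e^{−δ diam(cubes X)}`.
[cite: BalabanImbrieJaffe1988, §5.14 p.311–312] -/
theorem expand_decay_bound_init (hδ : 0 ≤ δ) (hr : 0 ≤ r₀)
    (hBd : ∀ u ∈ Dir, ∀ v ∈ Dir, |(A⁻¹ *ᵥ u) ⬝ᵥ v| ≤ B * Real.exp (-(δ * dist (loc u) (loc v))))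
    (hBf : ∀ u ∈ Dir, |(A⁻¹ *ᵥ u) ⬝ᵥ f| ≤ B) (hcM : 0 ≤ cM) (hcm : ∀ m, |c m| ≤ cM)
    (hobs : ∀ j, ∀ w ∈ obs j, w ∈ Dir) (hlegs : ∀ m, ∀ w ∈ legs m, w ∈ Dir)
    (hro : ∀ j, ∀ w ∈ obs j, ∀ w' ∈ obs j, dist (loc w) (loc w') ≤ r₀)
    (hrv : ∀ m, ∀ w ∈ legs m, ∀ w' ∈ legs m, dist (loc w) (loc w') ≤ r₀) (K : Finset κ) :
    ∀ t ∈ expand A f c legs obs M 0 K,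
      |t.coef| * Real.exp (δ * ((t.consts + t.groups).map fun h => Metric.diam (cubes loc obs h)).sum)
        ≤ (max B 1) ^ (∑ j ∈ K, ((obs j).length + 1 + M * maxArity legs)) * Real.exp (δ * (r₀ * K.card))
          * (cM * Real.exp (δ * r₀)) ^ t.nv := by
  intro t ht
  have h := expand_decay_bound hδ hr hBd hBf hcM hcm hobs hlegs hro hrv _ 0 K (Nat.lt_succ_self _)
    (fun h hh => absurd hh (Multiset.notMem_zero _)) t ht
  simpa only [Multiset.map_zero, Multiset.sum_zero, zero_add] using h

/-- **THE TERMS OF THE RESUMMED DISPLAY DECAY IN THE DIAMETERS OF THEIR COMPONENTS**: for `t ∈ expand 0 K`, its value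
`tval [] t = coef_t · ∫Π_{legs of t's X_r}Φ·(Π_{dirs t}∂)χ·e^{−V}dμ_{C,ℱ}` obeys
`|tval [] t| · exp(δ·Σ_X diam(cubes X)) ≤ (max B 1)^{Φ₀(K)} · e^{δr₀|K|} · (c_M e^{δr₀})^{nv_t} · |∫…|` — to be combined
with the small factors of `BIJ88LabelledCoefBound312.remainder_term_bound`. [cite: BalabanImbrieJaffe1988, §5.14 p.311–312] -/
theorem tval_decay_bound_init (hδ : 0 ≤ δ) (hr : 0 ≤ r₀)
    (hBd : ∀ u ∈ Dir, ∀ v ∈ Dir, |(A⁻¹ *ᵥ u) ⬝ᵥ v| ≤ B * Real.exp (-(δ * dist (loc u) (loc v))))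
    (hBf : ∀ u ∈ Dir, |(A⁻¹ *ᵥ u) ⬝ᵥ f| ≤ B) (hcM : 0 ≤ cM) (hcm : ∀ m, |c m| ≤ cM)
    (hobs : ∀ j, ∀ w ∈ obs j, w ∈ Dir) (hlegs : ∀ m, ∀ w ∈ legs m, w ∈ Dir)
    (hro : ∀ j, ∀ w ∈ obs j, ∀ w' ∈ obs j, dist (loc w) (loc w') ≤ r₀)
    (hrv : ∀ m, ∀ w ∈ legs m, ∀ w' ∈ legs m, dist (loc w) (loc w') ≤ r₀) (χ : (S → ℝ) → ℝ) (K : Finset κ) :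
    ∀ t ∈ expand A f c legs obs M 0 K,
      |tval A f c legs χ [] t| * Real.exp (δ * ((t.consts + t.groups).map fun h => Metric.diam (cubes loc obs h)).sum)
        ≤ (max B 1) ^ (∑ j ∈ K, ((obs j).length + 1 + M * maxArity legs)) * Real.exp (δ * (r₀ * K.card))
          * (cM * Real.exp (δ * r₀)) ^ t.nv
          * |gintM A f c legs χ ((t.groups.map fun h => (h.pend : Multiset (S → ℝ))).sum) t.dirs| := by
  intro t ht
  have h := expand_decay_bound_init hδ hr hBd hBf hcM hcm hobs hlegs hro hrv K t ht
  rw [tval, List.nil_append, abs_mul, mul_right_comm]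
  exact mul_le_mul_of_nonneg_right h (abs_nonneg _)

/-- **LARGE FACTORS × DECAY × SMALL FACTORS, PER TERM** (the three gen-17 bookkeepings together): for `c_M ≤ 1` and
`t ∈ expand 0 K`, `|tval [] t| · exp(δ·Σ_X diam(cubes X)) ≤ (max B 1)^{Φ₀(K)} · e^{δ r₀ (|K| + Φ₀(K))} · c_M^{M·#sat(t)} ·
|∫Π_{legs of t's X_r}Φ·(Π_{dirs t}∂)χ·e^{−V}dμ|` (`nv_t ≤ Φ₀(K)` by `expand_nv_le`, `c_M^{nv_t} ≤ c_M^{M·#sat(t)}` by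
`remainder_components_count`); the last integral carries the shell factor `√μ(Sh)` when `#χ′(t) ≥ 1`
(`BIJ88LabelledCoefBound312.remainder_term_bound`). [cite: BalabanImbrieJaffe1988, §5.14 p.311–312] -/
theorem tval_decay_small (hδ : 0 ≤ δ) (hr : 0 ≤ r₀)
    (hBd : ∀ u ∈ Dir, ∀ v ∈ Dir, |(A⁻¹ *ᵥ u) ⬝ᵥ v| ≤ B * Real.exp (-(δ * dist (loc u) (loc v))))
    (hBf : ∀ u ∈ Dir, |(A⁻¹ *ᵥ u) ⬝ᵥ f| ≤ B) (hcM : 0 ≤ cM) (hcM1 : cM ≤ 1) (hcm : ∀ m, |c m| ≤ cM)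
    (hobs : ∀ j, ∀ w ∈ obs j, w ∈ Dir) (hlegs : ∀ m, ∀ w ∈ legs m, w ∈ Dir)
    (hro : ∀ j, ∀ w ∈ obs j, ∀ w' ∈ obs j, dist (loc w) (loc w') ≤ r₀)
    (hrv : ∀ m, ∀ w ∈ legs m, ∀ w' ∈ legs m, dist (loc w) (loc w') ≤ r₀) (χ : (S → ℝ) → ℝ) (K : Finset κ) :
    ∀ t ∈ expand A f c legs obs M 0 K,
      |tval A f c legs χ [] t| * Real.exp (δ * ((t.consts + t.groups).map fun h => Metric.diam (cubes loc obs h)).sum)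
        ≤ (max B 1) ^ (∑ j ∈ K, ((obs j).length + 1 + M * maxArity legs))
          * Real.exp (δ * (r₀ * (K.card + ∑ j ∈ K, ((obs j).length + 1 + M * maxArity legs))))
          * cM ^ (M * Multiset.card (t.groups.filter fun g => M ≤ g.nv))
          * |gintM A f c legs χ ((t.groups.map fun h => (h.pend : Multiset (S → ℝ))).sum) t.dirs| := by
  intro t ht
  have h := tval_decay_bound_init hδ hr hBd hBf hcM hcm hobs hlegs hro hrv χ K t ht
  have hnv : t.nv ≤ ∑ j ∈ K, ((obs j).length + 1 + M * maxArity legs) := by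
    have := expand_nv_le (A := A) (f := f) (c := c) (legs := legs) (obs := obs) (M := M) _ 0 K (Nat.lt_succ_self _) t ht
    rwa [Multiset.map_zero, Multiset.sum_zero, zero_add] at this
  have hsat : M * Multiset.card (t.groups.filter fun g => M ≤ g.nv) ≤ t.nv :=
    (remainder_components_count (A := A) (f := f) (c := c) (legs := legs) (obs := obs) (M := M) K t ht).2.2.1
  have hm0 : 0 ≤ max B 1 := zero_le_one.trans (le_max_right B 1)
  refine h.trans (mul_le_mul_of_nonneg_right ?_ (abs_nonneg _))
  -- (cM e^{δ r₀})^{nv} ≤ e^{δ r₀ Φ₀} · cM^{M #sat}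
  rw [mul_pow, mul_assoc, mul_assoc]
  refine mul_le_mul_of_nonneg_left ?_ (pow_nonneg hm0 _)
  rw [← Real.exp_nat_mul]
  have hnv' : (t.nv : ℝ) ≤ ((∑ j ∈ K, ((obs j).length + 1 + M * maxArity legs) : ℕ) : ℝ) := by exact_mod_cast hnv
  calc Real.exp (δ * (r₀ * K.card)) * (cM ^ t.nv * Real.exp (t.nv * (δ * r₀)))
      = Real.exp (δ * (r₀ * K.card) + t.nv * (δ * r₀)) * cM ^ t.nv := by rw [Real.exp_add]; ring
    _ ≤ Real.exp (δ * (r₀ * (K.card + ((∑ j ∈ K, ((obs j).length + 1 + M * maxArity legs) : ℕ) : ℝ))))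
        * cM ^ (M * Multiset.card (t.groups.filter fun g => M ≤ g.nv)) :=
        mul_le_mul (Real.exp_le_exp.2 (by nlinarith [mul_nonneg hδ hr, hnv'])) (pow_le_pow_of_le_one hcM hcM1 hsat)
          (pow_nonneg hcM _) (Real.exp_pos _).le

end Expand

end Literature.MathematicalPhysics.QuantumFieldTheory.BalabanImbrieJaffe1984to88.BIJ88LabelledDiamDecay312

end
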